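import Summits.QuantumAdvantage.QuantumAdvantage.Theorems.SymplecticPurityGraphStateSpectrum
import Literature.Computability.AlgebraicComplexity.BooleanGadgets
import Literature.Combinatorics.Additive.CubeSumsets
import Mathlib.Combinatorics.Additive.Energy
import Mathlib.Analysis.SpecialFunctions.Pow.Real
import Mathlib.Analysis.SpecialFunctions.Log.Base
import Mathlib.Data.Nat.Log
import Mathlib.Tactic

/-!
# Crux `DlogGraphFlat` (stmt-QuantumAdvantage-10732), line `Sketch` — sector A: the spread-set
# energy bound modulo Stevens–de Zeeuw, real bookkeeping (`stub_dlogSpreadMain`)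

The purely numerical heart of "R4 modulo Stevens–de Zeeuw" (CORES.md §2 steps (3)–(5)): if a set
of size `Y⁴` has popular differences `≤ C₂(Q²Y³ + 1)`, sumsets with the sub-cubes `B_m`
(`|B_m| ≥ 2^{m−1}`) of size `≤ 4·3^m·2^{k−m}/2^m · …`, and `2^k ≤ 4 Q Y⁴`, then `Y⁴ ≤ 2^{68} C₂⁴ Q^{20}`:
choose `2^m ≈ Y/(4C₂Q²)`, get `(4/3)^m ≤ 16Q`, hence `2^{⌊m/3⌋} ≤ 16Q` and `Y < 2^{17} C₂ Q⁵`.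
No new definitions.
-/

set_option linter.dupNamespace false -- D-0017: single-problem summit ⇒ `QuantumAdvantage.QuantumAdvantage` by design

namespace Summit.QuantumAdvantage.QuantumAdvantage.Theorems.SymplecticPurity

/-- `2^{⌊m/3⌋} · 3^m ≤ 4^m` (i.e. `(4/3)^m ≥ 2^{⌊m/3⌋}`, from `54 ≤ 64` and `3 ≤ 4`). -/
theorem two_pow_div_three_mul_three_pow_le (m : ℕ) : 2 ^ (m / 3) * 3 ^ m ≤ 4 ^ m := by
  have hm : m = 3 * (m / 3) + m % 3 := (Nat.div_add_mod m 3).symm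
  set q := m / 3 with hq
  set r := m % 3 with hr
  have hr3 : r < 3 := Nat.mod_lt _ (by norm_num)
  rw [hm, pow_add, pow_add, pow_mul, pow_mul]
  have h1 : 2 ^ q * (3 ^ 3) ^ q ≤ (4 ^ 3) ^ q := by
    rw [← mul_pow]; exact Nat.pow_le_pow_left (by norm_num) q
  have h2 : 3 ^ r ≤ 4 ^ r := Nat.pow_le_pow_left (by norm_num) r
  calc 2 ^ q * ((3 ^ 3) ^ q * 3 ^ r) = (2 ^ q * (3 ^ 3) ^ q) * 3 ^ r := by ring
    _ ≤ (4 ^ 3) ^ q * 4 ^ r := Nat.mul_le_mul h1 h2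

/-- **Stub `stub_dlogSpreadMain`** (sector A, R4 modulo Stevens–de Zeeuw — the real bookkeeping):
with `Y⁴ = |A'|`, popular differences `≤ C₂(Q²Y³+1)`, the sub-cube sumset bounds for every admissible
block length `m`, and `2^k ≤ 4QY⁴`, one gets `Y⁴ ≤ 2^{68} C₂⁴ Q^{20}`. -/
theorem stub_dlogSpreadMain : ∀ (C₂ Q Y : ℝ) (k : ℕ), 1 ≤ C₂ → 1 ≤ Q → 1 ≤ Y →
    Y ≤ (2 : ℝ) ^ ((k : ℝ) / 4) → (2 : ℝ) ^ k ≤ 4 * Q * Y ^ 4 →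
    (∀ m : ℕ, 1 ≤ m → m ≤ k → (2 : ℝ) ^ m * (C₂ * (Q ^ 2 * Y ^ 3 + 1)) ≤ Y ^ 4 →
      Y ^ 4 * (2 : ℝ) ^ m ≤ 4 * (3 : ℝ) ^ m * (2 : ℝ) ^ (k - m)) →
    Y ^ 4 ≤ (2 : ℝ) ^ 68 * C₂ ^ 4 * Q ^ 20 := by
  intro C₂ Q Y k hC₂ hQ hY hYk hN hcomb
  have hY0 : 0 < Y := by linarith
  have hQ0 : 0 < Q := by linarith
  have hC0 : 0 < C₂ := by linarith
  by_cases hcase : Y < 8 * C₂ * Q ^ 2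
  · -- small case: Y⁴ < 2^12 C₂⁴ Q⁸ ≤ 2^68 C₂⁴ Q^20
    have h1 : Y ^ 4 ≤ (8 * C₂ * Q ^ 2) ^ 4 := pow_le_pow_left₀ hY0.le hcase.le 4
    have hQ8 : Q ^ 8 ≤ Q ^ 20 := pow_le_pow_right₀ hQ (by norm_num)
    have hC4 : (0 : ℝ) ≤ C₂ ^ 4 := by positivity
    calc Y ^ 4 ≤ (8 * C₂ * Q ^ 2) ^ 4 := h1
      _ = 2 ^ 12 * C₂ ^ 4 * Q ^ 8 := by ring
      _ ≤ 2 ^ 68 * C₂ ^ 4 * Q ^ 20 := by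
          have : (2 : ℝ) ^ 12 * C₂ ^ 4 ≤ 2 ^ 68 * C₂ ^ 4 := by nlinarith
          have h0 : (0 : ℝ) ≤ Q ^ 8 := by positivity
          nlinarith [mul_le_mul this hQ8 h0 (by positivity)]
  · push Not at hcase
    -- the block length m with 2^m ≤ X := Y/(4 C₂ Q²) < 2^(m+1)
    set X : ℝ := Y / (4 * C₂ * Q ^ 2) with hX
    have hden : 0 < 4 * C₂ * Q ^ 2 := by positivity
    have hX2 : 2 ≤ X := by rw [hX, le_div_iff₀ hden]; linarith
    set L : ℕ := ⌊X⌋₊ with hL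
    have hL2 : 2 ≤ L := by rw [hL]; exact Nat.le_floor (by exact_mod_cast hX2)
    have hL0 : L ≠ 0 := by omega
    set m : ℕ := Nat.log 2 L with hm
    have hmL : 2 ^ m ≤ L := Nat.pow_log_le_self 2 hL0
    have hLm : L < 2 ^ (m + 1) := Nat.lt_pow_succ_log_self (by norm_num) L
    have hm1 : 1 ≤ m := by
      rw [hm]; exact Nat.le_log_of_pow_le (by norm_num) (by simpa using hL2)
    have hLX : (L : ℝ) ≤ X := Nat.floor_le (by linarith)
    have hXL : X < (L : ℝ) + 1 := Nat.lt_floor_add_one X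
    have h2m : (2 : ℝ) ^ m ≤ X := le_trans (by exact_mod_cast hmL) hLX
    have hX2m : X < (2 : ℝ) ^ (m + 1) := by
      have : ((L : ℝ) + 1) ≤ (2 : ℝ) ^ (m + 1) := by exact_mod_cast hLm
      linarith
    -- m ≤ k (indeed 2^m ≤ X ≤ Y ≤ 2^{k/4} ≤ 2^k)
    have hXY : X ≤ Y := by
      rw [hX, div_le_iff₀ hden]
      have : (1 : ℝ) ≤ 4 * C₂ * Q ^ 2 := by nlinarith [one_le_pow₀ (n := 2) hQ]
      nlinarith
    have hmk : m ≤ k := by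
      have h1 : (2 : ℝ) ^ (m : ℝ) ≤ (2 : ℝ) ^ ((k : ℝ) / 4) := by
        rw [Real.rpow_natCast]; exact h2m.trans (hXY.trans hYk)
      have h2 : (m : ℝ) ≤ (k : ℝ) / 4 := by
        rwa [Real.rpow_le_rpow_left_iff (by norm_num : (1 : ℝ) < 2)] at h1
      have h3 : (m : ℝ) ≤ k := by linarith [(Nat.cast_nonneg k : (0 : ℝ) ≤ k)]
      exact_mod_cast h3
    -- the admissibility condition 2^m · C₂ (Q² Y³ + 1) ≤ Y⁴
    have hY3 : Y ≤ Y ^ 4 := by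
      calc Y = Y ^ 1 := (pow_one Y).symm
        _ ≤ Y ^ 4 := pow_le_pow_right₀ hY (by norm_num)
    have hadm : (2 : ℝ) ^ m * (C₂ * (Q ^ 2 * Y ^ 3 + 1)) ≤ Y ^ 4 := by
      have h1 : (2 : ℝ) ^ m * (C₂ * (Q ^ 2 * Y ^ 3 + 1)) ≤ X * (C₂ * (Q ^ 2 * Y ^ 3 + 1)) :=
        mul_le_mul_of_nonneg_right h2m (by positivity)
      have h2 : X * (C₂ * (Q ^ 2 * Y ^ 3 + 1)) = Y ^ 4 / 4 + Y / (4 * Q ^ 2) := by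
        rw [hX]; field_simp
      have h3 : Y / (4 * Q ^ 2) ≤ Y ^ 4 / 4 := by
        rw [div_le_div_iff₀ (by positivity) (by norm_num)]
        have hQ2 : (1 : ℝ) ≤ Q ^ 2 := one_le_pow₀ hQ
        nlinarith
      linarith
    have hmain := hcomb m hm1 hmk hadm
    -- Y⁴ 4^m ≤ 16 Q 3^m Y⁴, hence 4^m ≤ 16 Q 3^m
    have hpow : (2 : ℝ) ^ (k - m) * (2 : ℝ) ^ m = (2 : ℝ) ^ k := by
      rw [← pow_add, Nat.sub_add_cancel hmk]
    have h43 : (4 : ℝ) ^ m ≤ 16 * Q * (3 : ℝ) ^ m := by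
      have h1 : Y ^ 4 * (2 : ℝ) ^ m * (2 : ℝ) ^ m ≤ 4 * (3 : ℝ) ^ m * (2 : ℝ) ^ k := by
        rw [← hpow, ← mul_assoc]
        exact mul_le_mul_of_nonneg_right hmain (by positivity)
      have h2 : Y ^ 4 * (4 : ℝ) ^ m ≤ (16 * Q * (3 : ℝ) ^ m) * Y ^ 4 := by
        have e4 : (4 : ℝ) ^ m = (2 : ℝ) ^ m * (2 : ℝ) ^ m := by rw [← mul_pow]; norm_num
        calc Y ^ 4 * (4 : ℝ) ^ m = Y ^ 4 * (2 : ℝ) ^ m * (2 : ℝ) ^ m := by rw [e4]; ring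
          _ ≤ 4 * (3 : ℝ) ^ m * (2 : ℝ) ^ k := h1
          _ ≤ 4 * (3 : ℝ) ^ m * (4 * Q * Y ^ 4) := mul_le_mul_of_nonneg_left hN (by positivity)
          _ = (16 * Q * (3 : ℝ) ^ m) * Y ^ 4 := by ring
      have hY4 : 0 < Y ^ 4 := by positivity
      nlinarith
    -- 2^{m/3} ≤ 16 Q and 2^m ≤ 4 · 8^{m/3}
    have hq1 : (2 : ℝ) ^ (m / 3) ≤ 16 * Q := by
      have hnat := two_pow_div_three_mul_three_pow_le m
      have hR : (2 : ℝ) ^ (m / 3) * (3 : ℝ) ^ m ≤ (4 : ℝ) ^ m := by exact_mod_cast hnat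
      have h3pos : (0 : ℝ) < (3 : ℝ) ^ m := by positivity
      nlinarith
    have hq2 : (2 : ℝ) ^ m ≤ 4 * ((2 : ℝ) ^ (m / 3)) ^ 3 := by
      have hle : m ≤ 3 * (m / 3) + 2 := by omega
      calc (2 : ℝ) ^ m ≤ (2 : ℝ) ^ (3 * (m / 3) + 2) := pow_le_pow_right₀ (by norm_num) hle
        _ = 4 * ((2 : ℝ) ^ (m / 3)) ^ 3 := by rw [pow_add, mul_comm 3 (m / 3), pow_mul]; ring
    have h2mQ : (2 : ℝ) ^ m ≤ 2 ^ 14 * Q ^ 3 := by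
      have h0 : (0 : ℝ) ≤ (2 : ℝ) ^ (m / 3) := by positivity
      calc (2 : ℝ) ^ m ≤ 4 * ((2 : ℝ) ^ (m / 3)) ^ 3 := hq2
        _ ≤ 4 * (16 * Q) ^ 3 := by
            have := pow_le_pow_left₀ h0 hq1 3
            linarith
        _ = 2 ^ 14 * Q ^ 3 := by ring
    -- Y = 4 C₂ Q² X < 4 C₂ Q² 2^{m+1} ≤ 2^17 C₂ Q⁵
    have hYb : Y ≤ 2 ^ 17 * C₂ * Q ^ 5 := by
      have h1 : Y = 4 * C₂ * Q ^ 2 * X := by rw [hX]; field_simp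
      have h2 : X ≤ 2 * (2 ^ 14 * Q ^ 3) := by
        have : (2 : ℝ) ^ (m + 1) = 2 * (2 : ℝ) ^ m := by rw [pow_succ]; ring
        rw [this] at hX2m; linarith
      rw [h1]
      have h0 : (0 : ℝ) ≤ 4 * C₂ * Q ^ 2 := by positivity
      calc 4 * C₂ * Q ^ 2 * X ≤ 4 * C₂ * Q ^ 2 * (2 * (2 ^ 14 * Q ^ 3)) :=
            mul_le_mul_of_nonneg_left h2 h0
        _ = 2 ^ 17 * C₂ * Q ^ 5 := by ring
    calc Y ^ 4 ≤ (2 ^ 17 * C₂ * Q ^ 5) ^ 4 := pow_le_pow_left₀ hY0.le hYb 4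
      _ = 2 ^ 68 * C₂ ^ 4 * Q ^ 20 := by ring

/-! ### Combinatorial lemmas for the spread set `c + S_b`, `S_b = {ofBits b − 2·ofBits u : u ≼ b}` -/

section SpreadLemmas

open Finset Literature.Computability.QuantumComplexity Literature.Computability.Cryptography
open Literature.Computability.AlgebraicComplexity.BoolGadgets (ofBits_eq_sum ofBits_injective)
open scoped Pointwise

variable {n : ℕ}

/-- Signed-digit values are at most two-to-one modulo an odd prime `p` with `2ⁿ ≤ 2p`:
the fibres of `u ↦ c' − 2·ofBits u` on the patterns have at most two points. -/
theorem spread_fibre_le_two {p : ℕ} [hpf : Fact p.Prime] (hp2 : p ≠ 2) (h2p : 2 ^ n ≤ 2 * p)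
    (a : QReg n) (c' y : ZMod p) :
    ((Finset.univ.image fun u : QReg n => fun j => u j && a j).filter
        fun u => c' - 2 * (Nat.ofBits u : ZMod p) = y).card ≤ 2 := by
  classical
  have hp := hpf.out
  by_contra h
  push Not at h
  obtain ⟨u₁, hu₁, u₂, hu₂, u₃, hu₃, h12, h13, h23⟩ := Finset.two_lt_card.mp h
  have hcop : Nat.gcd p 2 = 1 := (Nat.coprime_primes hp Nat.prime_two).mpr hp2
  -- equal residues of ofBits
  have hres : ∀ u v : QReg n, u ∈ ((Finset.univ.image fun u : QReg n => fun j => u j && a j).filter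
        fun u => c' - 2 * (Nat.ofBits u : ZMod p) = y) →
      v ∈ ((Finset.univ.image fun u : QReg n => fun j => u j && a j).filter
        fun u => c' - 2 * (Nat.ofBits u : ZMod p) = y) →
      Nat.ofBits u % p = Nat.ofBits v % p := by
    intro u v hu hv
    rw [Finset.mem_filter] at hu hv
    have e : (2 * (Nat.ofBits u : ZMod p)) = 2 * (Nat.ofBits v : ZMod p) := by
      have := hu.2.trans hv.2.symm
      rwa [sub_right_inj] at this
    have e' : ((2 * Nat.ofBits u : ℕ) : ZMod p) = ((2 * Nat.ofBits v : ℕ) : ZMod p) := by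
      push_cast; exact e
    rw [ZMod.natCast_eq_natCast_iff] at e'
    exact Nat.ModEq.cancel_left_of_coprime hcop e'
  -- quotients are ≤ 1
  have hquo : ∀ u : QReg n, Nat.ofBits u / p ≤ 1 := by
    intro u
    have hu : Nat.ofBits u < 2 * p := (Nat.ofBits_lt_two_pow u).trans_le h2p
    have : Nat.ofBits u / p < 2 := Nat.div_lt_of_lt_mul (by linarith)
    omega
  have hdecomp : ∀ u : QReg n, Nat.ofBits u = Nat.ofBits u % p + p * (Nat.ofBits u / p) :=
    fun u => (Nat.mod_add_div _ _).symm
  have hne : ∀ u v : QReg n, u ≠ v → Nat.ofBits u ≠ Nat.ofBits v :=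
    fun u v huv e => huv (ofBits_injective e)
  have r12 := hres u₁ u₂ hu₁ hu₂
  have r13 := hres u₁ u₃ hu₁ hu₃
  have n12 := hne u₁ u₂ h12
  have n13 := hne u₁ u₃ h13
  have n23 := hne u₂ u₃ h23
  have d1 := hdecomp u₁; have d2 := hdecomp u₂; have d3 := hdecomp u₃
  have q1 := hquo u₁; have q2 := hquo u₂; have q3 := hquo u₃
  -- pigeonhole on the quotients in {0, 1}
  rcases Nat.le_one_iff_eq_zero_or_eq_one.mp q1 with e1 | e1 <;>
    rcases Nat.le_one_iff_eq_zero_or_eq_one.mp q2 with e2 | e2 <;>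
      rcases Nat.le_one_iff_eq_zero_or_eq_one.mp q3 with e3 | e3 <;>
        simp only [e1, e2, e3, mul_zero, mul_one, add_zero] at d1 d2 d3 <;> omega

/-- In a field, the multiplicative energy of a zero-free set is at most `|A|³`. -/
theorem mulEnergy_le_card_pow_three {F : Type*} [Field F] [DecidableEq F] (A : Finset F)
    (hA0 : (0 : F) ∉ A) : Finset.mulEnergy A A ≤ A.card ^ 3 := by
  unfold Finset.mulEnergy
  have hc : ((A ×ˢ A) ×ˢ A).card = A.card ^ 3 := by
    rw [Finset.card_product, Finset.card_product]; ring
  rw [← hc]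
  refine Finset.card_le_card_of_injOn (fun y => (y.1, y.2.1)) ?_ ?_
  · intro y hy
    simp only [Finset.mem_coe, Finset.mem_filter, Finset.mem_product] at hy ⊢
    exact ⟨⟨hy.1.1.1, hy.1.1.2⟩, hy.1.2.1⟩
  · intro y hy y' hy' h
    simp only [Finset.mem_coe, Finset.mem_filter, Finset.mem_product] at hy hy'
    simp only [Prod.mk.injEq] at h
    obtain ⟨h1, h2⟩ := h
    have ha2 : y.1.2 ≠ 0 := fun e => hA0 (e ▸ hy.1.1.2)
    have e1 := hy.2
    have e2 := hy'.2
    rw [← h1, ← h2] at e2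
    have : y.2.2 = y'.2.2 := mul_left_cancel₀ ha2 (e1.symm.trans e2)
    exact Prod.ext h1 (Prod.ext h2 this)

/-- Sub-masks of prescribed size exist. -/
theorem exists_submask (b : QReg n) (m : ℕ) (hm : m ≤ (Finset.univ.filter fun j => b j = true).card) :
    ∃ b'' : QReg n, (∀ j, b'' j = true → b j = true) ∧
      (Finset.univ.filter fun j => b'' j = true).card = m := by
  classical
  obtain ⟨J, hJ, hJm⟩ := Finset.exists_subset_card_eq hm
  refine ⟨fun j => decide (j ∈ J), fun j hj => ?_, ?_⟩
  · have : j ∈ J := by simpa using hj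
    exact (Finset.mem_filter.mp (hJ this)).2
  · rw [← hJm]; congr 1; ext j; simp

/-- The sumset of a subset of the translated spread set `c + S_b` with the spread set `S_{b''}` of a
sub-mask is small: `|A' + S_{b''}| ≤ 3^{|b''|} 2^{|b ∖ b''|}` (cube + sub-cube). -/
theorem card_add_spread_le {p : ℕ} [Fact p.Prime] (b b'' : QReg n) (hsub : ∀ j, b'' j = true → b j = true)
    (c : ZMod p) (A' : Finset (ZMod p))
    (hA' : A' ⊆ (Finset.univ.image fun u : QReg n => fun j => u j && b j).image
      fun u => c + ((Nat.ofBits b : ZMod p) - 2 * (Nat.ofBits u : ZMod p))) :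
    (A' + (Finset.univ.image fun u : QReg n => fun j => u j && b'' j).image
        fun u => (Nat.ofBits b'' : ZMod p) - 2 * (Nat.ofBits u : ZMod p)).card ≤
      3 ^ (Finset.univ.filter fun j => b'' j = true).card *
        2 ^ (Finset.univ.filter fun j => b j = true ∧ b'' j = false).card := by
  classical
  refine le_trans ?_ (Literature.Combinatorics.Additive.card_cube_add_subcube_le
    (M := ℕ) (fun j : Fin n => 2 ^ (j : ℕ)) b b'' hsub)
  refine le_trans (Finset.card_le_card (t := ((Finset.univ ×ˢ Finset.univ).image
      fun uu : (Fin n → Bool) × (Fin n → Bool) =>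
        ∑ j, ((uu.1 j && b j).toNat + (uu.2 j && b'' j).toNat) • (2 ^ (j : ℕ))).image
      fun s : ℕ => (c + (Nat.ofBits b : ZMod p) + (Nat.ofBits b'' : ZMod p)) - 2 * (s : ZMod p)) ?_)
    Finset.card_image_le
  intro z hz
  rw [Finset.mem_add] at hz
  obtain ⟨a, ha, β, hβ, rfl⟩ := hz
  have ha' := hA' ha
  simp only [Finset.mem_image, Finset.mem_univ, true_and] at ha' hβ
  obtain ⟨_, ⟨u, rfl⟩, rfl⟩ := ha'
  obtain ⟨_, ⟨u'', rfl⟩, rfl⟩ := hβ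
  rw [Finset.mem_image]
  refine ⟨∑ j, (((u j && b j) && b j).toNat + ((u'' j && b'' j) && b'' j).toNat) • (2 ^ (j : ℕ)),
    Finset.mem_image.mpr ⟨(fun j => u j && b j, fun j => u'' j && b'' j),
      Finset.mem_product.mpr ⟨Finset.mem_univ _, Finset.mem_univ _⟩, rfl⟩, ?_⟩
  have e1 : Nat.ofBits (fun j => u j && b j) + Nat.ofBits (fun j => u'' j && b'' j) =
      ∑ j, (((u j && b j) && b j).toNat + ((u'' j && b'' j) && b'' j).toNat) • (2 ^ (j : ℕ)) := by
    rw [ofBits_eq_sum, ofBits_eq_sum, ← Finset.sum_add_distrib]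
    refine Finset.sum_congr rfl fun j _ => ?_
    rw [smul_eq_mul, add_mul]
    cases u j <;> cases b j <;> cases u'' j <;> cases b'' j <;> simp
  rw [← e1]
  push_cast
  ring

/-- Real bookkeeping for the popular differences: from Stevens–de Zeeuw in the form
`r·|A'|² ≤ C₂(M^{5/4}|A'|^{3/2} + |A'|²)` with `M ≤ Q|A'|`, `|A'| = Y⁴`: `r ≤ C₂'(Q²Y³ + 1)`. -/
theorem popdiff_numerics (r M A Q Y C₂ C₂' : ℝ) (hA : A = Y ^ 4) (hY : 1 ≤ Y) (hQ : 1 ≤ Q)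
    (hC : 0 ≤ C₂) (hCC : C₂ ≤ C₂') (hM0 : 0 ≤ M) (hM : M ≤ Q * A)
    (h : r * A ^ 2 ≤ C₂ * (M ^ (5 / 4 : ℝ) * A ^ (3 / 2 : ℝ) + A ^ 2)) :
    r ≤ C₂' * (Q ^ 2 * Y ^ 3 + 1) := by
  have hY0 : 0 ≤ Y := by linarith
  have hQ0 : 0 ≤ Q := by linarith
  have hA0 : 0 ≤ A := by rw [hA]; positivity
  have hArpow : ∀ t : ℝ, A ^ t = Y ^ (4 * t) := by
    intro t; rw [hA, ← Real.rpow_natCast Y 4, ← Real.rpow_mul hY0]; norm_num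
  have e1 : A ^ (3 / 2 : ℝ) = Y ^ 6 := by
    rw [hArpow]; norm_num
  have e2 : A ^ (5 / 4 : ℝ) = Y ^ 5 := by
    rw [hArpow]; norm_num
  have hM54 : M ^ (5 / 4 : ℝ) ≤ Q ^ 2 * Y ^ 5 := by
    calc M ^ (5 / 4 : ℝ) ≤ (Q * A) ^ (5 / 4 : ℝ) := Real.rpow_le_rpow hM0 hM (by norm_num)
      _ = Q ^ (5 / 4 : ℝ) * A ^ (5 / 4 : ℝ) := Real.mul_rpow hQ0 hA0
      _ ≤ Q ^ (2 : ℝ) * A ^ (5 / 4 : ℝ) :=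
          mul_le_mul_of_nonneg_right (Real.rpow_le_rpow_of_exponent_le hQ (by norm_num))
            (by positivity)
      _ = Q ^ 2 * Y ^ 5 := by rw [e2, Real.rpow_two]
  have h2 : r * Y ^ 8 ≤ C₂ * (Q ^ 2 * Y ^ 3 + 1) * Y ^ 8 := by
    have hA2 : A ^ 2 = Y ^ 8 := by rw [hA]; ring
    calc r * Y ^ 8 = r * A ^ 2 := by rw [hA2]
      _ ≤ C₂ * (M ^ (5 / 4 : ℝ) * A ^ (3 / 2 : ℝ) + A ^ 2) := h
      _ ≤ C₂ * (Q ^ 2 * Y ^ 5 * Y ^ 6 + Y ^ 8) := by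
          rw [e1, hA2]
          refine mul_le_mul_of_nonneg_left ?_ hC
          nlinarith [pow_nonneg hY0 6]
      _ = C₂ * (Q ^ 2 * Y ^ 3 + 1) * Y ^ 8 := by ring
  have hY8 : 0 < Y ^ 8 := by positivity
  have h3 : r ≤ C₂ * (Q ^ 2 * Y ^ 3 + 1) := le_of_mul_le_mul_right h2 hY8
  have h4 : C₂ * (Q ^ 2 * Y ^ 3 + 1) ≤ C₂' * (Q ^ 2 * Y ^ 3 + 1) :=
    mul_le_mul_of_nonneg_right hCC (by positivity)
  linarith

/-- Final real bookkeeping: from `|A| ≤ C₉ K^e` with `K = |A|³/E`, `E ≤ C₉^{1/e} |A|^{3 − 1/e}`. -/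
theorem energy_from_K_bound (a E C₉ e : ℝ) (ha : 0 < a) (hE : 0 < E) (hC₉ : 1 ≤ C₉) (he : 0 < e)
    (h : a ≤ C₉ * (a ^ 3 / E) ^ e) : E ≤ C₉ ^ (1 / e) * a ^ (3 - 1 / e) := by
  have hK0 : 0 < a ^ 3 / E := by positivity
  -- K ≥ (a / C₉)^{1/e}
  have h1 : a / C₉ ≤ (a ^ 3 / E) ^ e := by
    rw [div_le_iff₀ (by linarith)]; linarith [mul_comm C₉ ((a ^ 3 / E) ^ e)]
  have h2 : (a / C₉) ^ (1 / e) ≤ a ^ 3 / E := by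
    have := Real.rpow_le_rpow (by positivity) h1 (by positivity : (0 : ℝ) ≤ 1 / e)
    rwa [← Real.rpow_mul hK0.le, mul_one_div_cancel he.ne', Real.rpow_one] at this
  -- E ≤ a³ / (a/C₉)^{1/e} = C₉^{1/e} a^{3 - 1/e}
  have h3 : 0 < (a / C₉) ^ (1 / e) := by positivity
  have h4 : E ≤ a ^ 3 / (a / C₉) ^ (1 / e) := by
    rw [le_div_iff₀ h3]
    calc E * (a / C₉) ^ (1 / e) ≤ E * (a ^ 3 / E) := mul_le_mul_of_nonneg_left h2 hE.le
      _ = a ^ 3 := by field_simp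
  refine h4.trans (le_of_eq ?_)
  rw [Real.div_rpow ha.le (by linarith), Real.rpow_sub ha, ← Real.rpow_natCast a 3]
  field_simp
  ring_nf

/-- Admissibility `t · C (Q²Y³ + 1) ≤ Y⁴` with `t ≥ 2`, `C ≥ 1` forces `Q ≤ Y`. -/
theorem adm_Q_le_Y (Q Y C t : ℝ) (hQ : 1 ≤ Q) (hY : 1 ≤ Y) (hC : 1 ≤ C) (ht : 2 ≤ t)
    (h : t * (C * (Q ^ 2 * Y ^ 3 + 1)) ≤ Y ^ 4) : Q ≤ Y := by
  have hY0 : 0 < Y := by linarith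
  have hY3 : 0 < Y ^ 3 := by positivity
  have h0 : 0 ≤ Q ^ 2 * Y ^ 3 + 1 := by positivity
  have h1 : Q ^ 2 * Y ^ 3 + 1 ≤ t * (C * (Q ^ 2 * Y ^ 3 + 1)) := by
    have : 1 * (1 * (Q ^ 2 * Y ^ 3 + 1)) ≤ t * (C * (Q ^ 2 * Y ^ 3 + 1)) :=
      mul_le_mul (by linarith) (mul_le_mul_of_nonneg_right hC h0) (by positivity) (by linarith)
    linarith
  have h2 : Q ^ 2 * Y ^ 3 ≤ Y * Y ^ 3 := by nlinarith
  have h3 : Q ^ 2 ≤ Y := le_of_mul_le_mul_right h2 hY3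
  nlinarith

end SpreadLemmas

end Summit.QuantumAdvantage.QuantumAdvantage.Theorems.SymplecticPurity
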